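import Summits.CriticalPhenomena.PercolationContinuityZ3.Theorems.PercNearOneGluingNoHeavyLowerTailSahiTripartitionULC
import Mathlib
import HarnessLib
import HarnessLib.Audit.Tags

/-!
# `NoHeavyLowerTail` (crux stmt-CriticalPhenomena-4575), master-family line P1 (gen 19):
# the DISTANCE-TWO inequality for ordered tripartitions — `#{X,Y,Z ∈ u}·#all ≤ #{X ∈ u}·#{Y,Z ∈ u}` (THEOREM)

Support file (seat `prim-masterthm-p1`, gen 19; `--supports stmt-CriticalPhenomena-4575`), on top of `…SahiTripartitionULC` (gen 17: `triCount`,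
the degree-1 theorem `triCount_and_mul_le`).  Memo `run/shared/lean/prim/prim-masterthm/FROM-prim-masterthm-p1-g19-ULC-REFUTATION.md` §4.

With `p_k = P(k given cells of a uniform random ordered tripartition lie in u)` for a monotone `u`, the tree knows `p₂ ≤ p₁²` (NA, gen 17) and,
since gen 19, that `p₁p₃ ≤ p₂²` (Half A) is FALSE.  The product of the two would have given `p₃ ≤ p₁p₂`; this file proves that weaker
"log-concavity at distance two" directly, so it SURVIVES the refutation:
* `pairIn u W` = number of ordered complementary member pairs `(y, W \ y)` inside the window `W`; its density `pairIn u W / 2^{|W|}` is monotone in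
  the window (`pairIn_mul_pow_le`: the injection `(y, T) ↦ y ∪ T`, `T ⊆ W' \ W`);
* **THEOREM `triCount_all3_mul_le`**: `#{X,Y,Z ∈ u}·#{all} ≤ #{X ∈ u}·#{Y,Z ∈ u}`, i.e. `P(X,Y,Z ∈ u) ≤ P(X ∈ u)·P(Y,Z ∈ u)` — condition on the first
  cell: `1_u(X)` is monotone in `X`, the pair density of the complement window is antitone in `X`, FKG on `Finset ι` with the log-modular weight
  `2^{|Xᶜ|}` (Mathlib `fkg`), exactly as in the degree-1 theorem.
In the pattern classes `A_k` (gen 19 `…PatternCounts`) this reads `A₃(A₀+3A₁+3A₂+A₃) ≤ (A₁+2A₂+A₃)(A₂+A₃)`; together with NA and the open pure Half B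
it is one of the valid constraints on ACHIEVABLE block statistics `(d,a,b,g)` that the composite attack on `PivotDichotomy` has to respect.
HONEST FRAMING: one proved inequality (Harris/FKG level); Half B, PivotDichotomy, S₃^max remain OPEN. [this work]
-/

namespace Summit.CriticalPhenomena.PercolationContinuityZ3.Theorems

namespace SahiTripartition

open Finset

variable {ι : Type*} [Fintype ι] [DecidableEq ι]

/-! ### 1. Complementary member pairs inside a window -/

/-- `pairIn u W` = number of `y ⊆ W` with `y ∈ u` and `W \ y ∈ u` (ordered complementary member pairs inside the window `W`). [this work] -/
def pairIn (u : Finset ι → Bool) (W : Finset ι) : ℕ := ((W.powerset).filter fun y => (u y && u (W \ y)) = true).card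

omit [Fintype ι] in
/-- `pairIn u W ≤ 2^{|W|}`. [this work] -/
theorem pairIn_le_pow (u : Finset ι → Bool) (W : Finset ι) : pairIn u W ≤ 2 ^ W.card := by
  unfold pairIn; rw [← card_powerset]; exact card_filter_le _ _

omit [Fintype ι] in
/-- The pair density is monotone in the window: for `W ⊆ W'`, `pairIn u W / 2^{|W|} ≤ pairIn u W' / 2^{|W'|}` (cross-multiplied).
Proof: `(y, T) ↦ y ∪ T` (`T ⊆ W' \ W`) is injective from pairs of `W` times subsets of `W' \ W` into pairs of `W'` (monotonicity of `u`). [this work] -/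
theorem pairIn_mul_pow_le (u : Finset ι → Bool) (hu : Monotone u) {W W' : Finset ι} (h : W ⊆ W') :
    pairIn u W * 2 ^ W'.card ≤ pairIn u W' * 2 ^ W.card := by
  classical
  have hc : (W' \ W).card + W.card = W'.card := card_sdiff_add_card_eq_card h
  -- it suffices: pairIn u W * 2^{|W' \ W|} ≤ pairIn u W'
  suffices key : pairIn u W * 2 ^ (W' \ W).card ≤ pairIn u W' by
    calc pairIn u W * 2 ^ W'.card = pairIn u W * 2 ^ (W' \ W).card * 2 ^ W.card := by rw [← hc, pow_add]; ring
      _ ≤ pairIn u W' * 2 ^ W.card := Nat.mul_le_mul_right _ key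
  unfold pairIn
  set A := (W.powerset).filter fun y => (u y && u (W \ y)) = true with hA
  set B := (W'.powerset).filter fun y => (u y && u (W' \ y)) = true with hB
  rw [← card_powerset, ← card_product]
  refine card_le_card_of_injOn (fun p => p.1 ∪ p.2) (fun p hp => ?_) (fun p hp q hq heq => ?_)
  · -- lands in B
    rw [mem_coe, mem_product, hA, mem_filter, mem_powerset, mem_powerset] at hp
    obtain ⟨⟨hyW, hy⟩, hT⟩ := hp
    rw [Bool.and_eq_true] at hy
    rw [mem_coe, hB, mem_filter, mem_powerset, Bool.and_eq_true]
    refine ⟨union_subset (hyW.trans h) (hT.trans sdiff_subset), ?_, ?_⟩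
    · exact le_antisymm (Bool.le_true _) (hy.1 ▸ hu (subset_union_left (s₁ := p.1) (s₂ := p.2)))
    · have hsub : W \ p.1 ⊆ W' \ (p.1 ∪ p.2) := by
        intro v hv
        rw [mem_sdiff] at hv ⊢
        refine ⟨h hv.1, ?_⟩
        rw [mem_union, not_or]
        exact ⟨hv.2, fun hvT => (mem_sdiff.mp (hT hvT)).2 hv.1⟩
      exact le_antisymm (Bool.le_true _) (hy.2 ▸ hu hsub)
  · -- injective: p.1 = (p.1 ∪ p.2) ∩ W, p.2 = (p.1 ∪ p.2) \ W
    rw [mem_coe, mem_product, hA, mem_filter, mem_powerset, mem_powerset] at hp hq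
    have e1 : ∀ r : Finset ι × Finset ι, r.1 ⊆ W → r.2 ⊆ W' \ W → (r.1 ∪ r.2) ∩ W = r.1 := by
      intro r h1 h2; ext v; rw [mem_inter, mem_union]
      constructor
      · rintro ⟨hv | hv, hvW⟩
        · exact hv
        · exact absurd hvW (mem_sdiff.mp (h2 hv)).2
      · exact fun hv => ⟨Or.inl hv, h1 hv⟩
    have e2 : ∀ r : Finset ι × Finset ι, r.1 ⊆ W → r.2 ⊆ W' \ W → (r.1 ∪ r.2) \ W = r.2 := by
      intro r h1 h2; ext v; rw [mem_sdiff, mem_union]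
      constructor
      · rintro ⟨hv | hv, hvW⟩
        · exact absurd (h1 hv) hvW
        · exact hv
      · exact fun hv => ⟨Or.inr hv, (mem_sdiff.mp (h2 hv)).2⟩
    have heq' : p.1 ∪ p.2 = q.1 ∪ q.2 := heq
    have k1 := e1 p hp.1.1 hp.2; have k2 := e2 p hp.1.1 hp.2
    have k3 := e1 q hq.1.1 hq.2; have k4 := e2 q hq.1.1 hq.2
    rw [heq'] at k1 k2
    exact Prod.ext (k1.symm.trans k3) (k2.symm.trans k4)

/-! ### 2. Pattern counts as single sums over the first cell -/

/-- `#{X,Y,Z ∈ u} = Σ_{X ∈ u} pairIn u Xᶜ`. [this work] -/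
theorem triCount_all3_eq (u : Finset ι → Bool) :
    triCount u (fun a b d => a && b && d) = ∑ x : Finset ι, if u x = true then pairIn u xᶜ else 0 := by
  unfold triCount pairIn
  refine sum_congr rfl fun x _ => ?_
  rcases hx : u x with _ | _ <;> simp

/-- `#{Y,Z ∈ u} = Σ_X pairIn u Xᶜ`. [this work] -/
theorem triCount_snd_thd_eq (u : Finset ι → Bool) :
    triCount u (fun _ b d => b && d) = ∑ x : Finset ι, pairIn u xᶜ := rfl

/-! ### 3. The distance-two inequality -/

/-- **THEOREM (log-concavity at distance two).**  For a monotone property `u` and a uniform random ordered tripartition `(X,Y,Z)`: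
`P(X,Y,Z ∈ u) ≤ P(X ∈ u)·P(Y,Z ∈ u)`, i.e. `#{X,Y,Z ∈ u}·#{all} ≤ #{X ∈ u}·#{Y,Z ∈ u}`.  Proof: condition on `X`; the pair density of
`u` in `2^{Xᶜ}` is antitone in `X`; FKG on `Finset ι` with the log-modular weight `2^{|Xᶜ|}`. [this work] -/
theorem triCount_all3_mul_le (u : Finset ι → Bool) (hu : Monotone u) :
    triCount u (fun a b d => a && b && d) * triCount u (fun _ _ _ => true) ≤
      triCount u (fun a _ _ => a) * triCount u (fun _ b d => b && d) := by
  classical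
  set μ : Finset ι → ℚ := fun x => 2 ^ xᶜ.card with hμ
  set f : Finset ι → ℚ := fun x => if u x = true then 1 else 0 with hf
  set g : Finset ι → ℚ := fun x => ((2 : ℚ) ^ xᶜ.card - pairIn u xᶜ) / 2 ^ xᶜ.card with hg
  have hμ0 : 0 ≤ μ := fun x => by positivity
  have hf0 : 0 ≤ f := fun x => by simp only [hf, Pi.zero_apply]; split_ifs <;> norm_num
  have hg0 : 0 ≤ g := fun x => by
    simp only [hg, Pi.zero_apply]
    apply div_nonneg _ (by positivity)
    have := pairIn_le_pow u xᶜ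
    have h' : (pairIn u xᶜ : ℚ) ≤ (2 : ℚ) ^ xᶜ.card := by exact_mod_cast this
    linarith
  have hfm : Monotone f := by
    intro x y hxy
    simp only [hf]
    split_ifs with h1 h2 <;> norm_num
    exact absurd (le_antisymm (Bool.le_true _) (h1 ▸ hu hxy)) h2
  have hgm : Monotone g := by
    intro x y hxy
    simp only [hg]
    have hsub : yᶜ ⊆ xᶜ := compl_subset_compl.mpr hxy
    have key := pairIn_mul_pow_le u hu hsub
    have key' : (pairIn u yᶜ : ℚ) * 2 ^ xᶜ.card ≤ (pairIn u xᶜ : ℚ) * 2 ^ yᶜ.card := by exact_mod_cast key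
    rw [div_le_div_iff₀ (by positivity) (by positivity)]
    nlinarith [key']
  have hμl : ∀ a b, μ a * μ b ≤ μ (a ⊓ b) * μ (a ⊔ b) := by
    intro a b
    simp only [hμ, ← pow_add]
    apply le_of_eq
    congr 1
    rw [inf_eq_inter, sup_eq_union, compl_inter, compl_union, add_comm (aᶜ ∪ bᶜ).card,
      card_inter_add_card_union]
  have FKG := fkg (μ := μ) (f := f) (g := g) hμ0 hf0 hg0 hfm hgm hμl
  -- identify the four sums
  have s1 : ∑ x, μ x * f x = ∑ x : Finset ι, if u x = true then (2 : ℚ) ^ xᶜ.card else 0 := by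
    refine sum_congr rfl fun x _ => ?_; simp only [hμ, hf]; split_ifs <;> ring
  have s2 : ∑ x, μ x * g x = ∑ x : Finset ι, ((2 : ℚ) ^ xᶜ.card - pairIn u xᶜ) := by
    refine sum_congr rfl fun x _ => ?_
    simp only [hμ, hg]
    rw [mul_div_cancel₀ _ (by positivity)]
  have s3 : ∑ x, μ x = ∑ x : Finset ι, (2 : ℚ) ^ xᶜ.card := rfl
  have s4 : ∑ x, μ x * (f x * g x) = ∑ x : Finset ι, if u x = true then ((2 : ℚ) ^ xᶜ.card - pairIn u xᶜ) else 0 := by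
    refine sum_congr rfl fun x _ => ?_
    simp only [hμ, hf, hg]
    split_ifs
    · rw [one_mul, mul_div_cancel₀ _ (by positivity)]
    · ring
  rw [s1, s2, s3, s4] at FKG
  rw [triCount_all3_eq, triCount_true_eq, triCount_fst_eq, triCount_snd_thd_eq]
  have e11 : ((∑ x : Finset ι, if u x = true then pairIn u xᶜ else 0 : ℕ) : ℚ)
      = ∑ x : Finset ι, if u x = true then (pairIn u xᶜ : ℚ) else 0 := by
    push_cast; refine sum_congr rfl fun x _ => ?_; split_ifs <;> simp
  have e10 : ((∑ x : Finset ι, if u x = true then 2 ^ xᶜ.card else 0 : ℕ) : ℚ)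
      = ∑ x : Finset ι, if u x = true then (2 : ℚ) ^ xᶜ.card else 0 := by
    push_cast; refine sum_congr rfl fun x _ => ?_; split_ifs <;> simp
  have e00 : ((∑ x : Finset ι, 2 ^ xᶜ.card : ℕ) : ℚ) = ∑ x : Finset ι, (2 : ℚ) ^ xᶜ.card := by push_cast; rfl
  have e01 : ((∑ x : Finset ι, pairIn u xᶜ : ℕ) : ℚ) = ∑ x : Finset ι, (pairIn u xᶜ : ℚ) := by push_cast; rfl
  have split2 : ∑ x : Finset ι, ((2 : ℚ) ^ xᶜ.card - pairIn u xᶜ)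
      = ∑ x : Finset ι, (2 : ℚ) ^ xᶜ.card - ∑ x : Finset ι, (pairIn u xᶜ : ℚ) := sum_sub_distrib _ _
  have split4 : ∑ x : Finset ι, (if u x = true then ((2 : ℚ) ^ xᶜ.card - pairIn u xᶜ) else 0)
      = (∑ x : Finset ι, if u x = true then (2 : ℚ) ^ xᶜ.card else 0)
        - ∑ x : Finset ι, if u x = true then (pairIn u xᶜ : ℚ) else 0 := by
    rw [← sum_sub_distrib]; refine sum_congr rfl fun x _ => ?_; split_ifs <;> ring
  rw [split2, split4] at FKG
  have goal : ((∑ x : Finset ι, if u x = true then pairIn u xᶜ else 0 : ℕ) : ℚ) * ((∑ x : Finset ι, 2 ^ xᶜ.card : ℕ) : ℚ)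
      ≤ ((∑ x : Finset ι, if u x = true then 2 ^ xᶜ.card else 0 : ℕ) : ℚ) * ((∑ x : Finset ι, pairIn u xᶜ : ℕ) : ℚ) := by
    rw [e11, e10, e00, e01]
    nlinarith [FKG]
  exact_mod_cast goal

end SahiTripartition

end Summit.CriticalPhenomena.PercolationContinuityZ3.Theorems
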